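import Mathlib
import Summits.Ventures.HodgeRepro2.T5PrincipalUnitFiltration
import Summits.Ventures.HodgeRepro2.T5PrincipalUnitComparison

/-!
# The index of the higher unit groups, and the count `[U_E : U_F U_E^n] = (q+1) q^{n−1}`

Lemma N5.L4(iii) of `route/TIER5.md` §N5.11.4 (COUNTS at an inert place) and Theorem N5.T3
(§N5.11.6: «`G := E¹_w/(E¹_w ∩ U²)`, a finite abelian group of order `(q_w+1) q_w`») use the
index «`[U_E : U_F U_E^n] = (q+1) q^{n−1}` (`n ≥ 1`)» at an inert place `v` (`q := q_F`,
`q_{E_v} = q²`). This file checks it from the filtration quotients of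
`T5PrincipalUnitFiltration`:

* `relIndex_higherUnits_succ`, `index_higherUnits_one`, `index_higherUnits`: for a discrete
  valuation ring `R` with residue field `k`, `[Rˣ : U^n] = |kˣ| · |k|^{n−1}` (`n ≥ 1`) —
  `U^n/U^{n+1} ≅ k` and `Rˣ/U^1 ≅ kˣ`;
* `comap_unitsMap_higherUnits`: at a place with a common uniformiser (inert) the base units meet
  `U_S^n` exactly in `U_R^n` (the saturation of `T5PrincipalUnitComparison`);
* `relIndex_higherUnits_sup_range`: `[U_F U_S^n : U_S^n] = [U_F : U_F^n]` (second isomorphism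
  theorem, `unitsMap` injective);
* `index_sup_mul_eq`: `[Sˣ : U_F U_S^n] · |k_Rˣ| · |k_R|^{n−1} = |k_Sˣ| · |k_S|^{n−1}`, and
  `index_sup_eq_of_card` the prose count `[U_E : U_F U_E^n] = (q+1) q^{n−1}` when
  `|k_F| = q`, `|k_E| = q²`.

Declaration per README §8(d): «uses an L-value-free non-vanishing device: NO».
-/

namespace Summit.Ventures.HodgeRepro2.T5HigherUnitsIndex

open T5PrincipalUnitFiltration T5PrincipalUnitComparison

section Index

variable {R : Type*} [CommRing R] [IsDomain R] [IsDiscreteValuationRing R] {ϖ : R}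

/-- `[U^n : U^{n+1}] = |k|` for `n ≥ 1`. -/
theorem relIndex_higherUnits_succ (hϖ : Irreducible ϖ) {n : ℕ} (hn : 1 ≤ n) :
    (higherUnits ϖ (n + 1)).relIndex (higherUnits ϖ n) =
      Nat.card (IsLocalRing.ResidueField R) := by
  show ((higherUnits ϖ (n + 1)).subgroupOf (higherUnits ϖ n)).index = _
  rw [Subgroup.index_eq_card]
  exact card_higherUnits_quot_eq_card_residueField ϖ n hϖ hn

/-- `[Rˣ : U^1] = |kˣ|`. -/
theorem index_higherUnits_one (hϖ : Irreducible ϖ) :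
    (higherUnits ϖ 1).index = Nat.card (IsLocalRing.ResidueField R)ˣ := by
  rw [Subgroup.index_eq_card]
  exact card_units_quot ϖ hϖ

/-- `[Rˣ : U^n] = |kˣ| · |k|^{n−1}` for `n ≥ 1`. -/
theorem index_higherUnits (hϖ : Irreducible ϖ) {n : ℕ} (hn : 1 ≤ n) :
    (higherUnits ϖ n).index =
      Nat.card (IsLocalRing.ResidueField R)ˣ * Nat.card (IsLocalRing.ResidueField R) ^ (n - 1) := by
  induction n with
  | zero => omega
  | succ m ih =>
    rcases Nat.eq_zero_or_pos m with rfl | hm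
    · simpa using index_higherUnits_one hϖ
    · rw [← Subgroup.relIndex_mul_index (higherUnits_succ_le ϖ m), relIndex_higherUnits_succ hϖ hm,
        ih hm]
      have e : m + 1 - 1 = (m - 1) + 1 := by omega
      rw [e, pow_succ]
      ring

end Index

section Inert

variable {R S : Type*} [CommRing R] [CommRing S] [Algebra R S] [IsDomain R] [IsDomain S]
  [IsDiscreteValuationRing R] [IsDiscreteValuationRing S] {ϖ : R}

/-- At a place with a common uniformiser (`ϖ` irreducible in `R` and in `S`) the base units
meet `U_S^n` exactly in `U_R^n`: `comap unitsMap (U_S^n) = U_R^n`. -/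
theorem comap_unitsMap_higherUnits (hinj : Function.Injective (algebraMap R S))
    (hϖ : Irreducible ϖ) (hϖS : Irreducible (algebraMap R S ϖ)) (n : ℕ) :
    (higherUnits (algebraMap R S ϖ) n).comap (unitsMap (R := R) (S := S)) = higherUnits ϖ n := by
  ext x
  rw [Subgroup.mem_comap, mem_higherUnits, mem_higherUnits]
  have e : ((unitsMap x : Sˣ) : S) - 1 = algebraMap R S ((x : R) - 1) := by
    rw [map_sub, map_one]; rfl
  rw [e]
  constructor
  · intro h
    exact dvd_of_dvd_algebraMap ϖ hinj hϖ hϖS n _ h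
  · intro h
    obtain ⟨c, hc⟩ := h
    exact ⟨algebraMap R S c, by rw [hc, map_mul, map_pow]⟩

omit [IsDomain R] [IsDomain S] [IsDiscreteValuationRing R] [IsDiscreteValuationRing S] in
/-- `unitsMap` is injective when `algebraMap R S` is. -/
theorem unitsMap_injective (hinj : Function.Injective (algebraMap R S)) :
    Function.Injective (unitsMap (R := R) (S := S)) :=
  Units.map_injective hinj

/-- The second isomorphism theorem in index form: `[U_F U_S^n : U_S^n] = [U_F : U_F^n]`, the base
units `U_F = image(Rˣ)` meeting `U_S^n` in `U_R^n`. -/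
theorem relIndex_higherUnits_sup_range (hinj : Function.Injective (algebraMap R S))
    (hϖ : Irreducible ϖ) (hϖS : Irreducible (algebraMap R S ϖ)) (n : ℕ) :
    (higherUnits (algebraMap R S ϖ) n).relIndex
        ((unitsMap (R := R) (S := S)).range ⊔ higherUnits (algebraMap R S ϖ) n) =
      (higherUnits ϖ n).index := by
  rw [Subgroup.relIndex_sup_right, ← Subgroup.relIndex_top_right, ← comap_unitsMap_higherUnits hinj
    hϖ hϖS n, Subgroup.relIndex_comap, ← MonoidHom.range_eq_map]

/-- `[Sˣ : U_F U_S^n] · [Rˣ : U_R^n] = [Sˣ : U_S^n]`. -/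
theorem index_sup_mul_index (hinj : Function.Injective (algebraMap R S))
    (hϖ : Irreducible ϖ) (hϖS : Irreducible (algebraMap R S ϖ)) (n : ℕ) :
    ((unitsMap (R := R) (S := S)).range ⊔ higherUnits (algebraMap R S ϖ) n).index *
        (higherUnits ϖ n).index = (higherUnits (algebraMap R S ϖ) n).index := by
  rw [← relIndex_higherUnits_sup_range hinj hϖ hϖS n, mul_comm]
  exact Subgroup.relIndex_mul_index le_sup_right

/-- THE COUNT in product form, `n ≥ 1`:
`[Sˣ : U_F U_S^n] · |k_Rˣ| · |k_R|^{n−1} = |k_Sˣ| · |k_S|^{n−1}`. -/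
theorem index_sup_mul_eq (hinj : Function.Injective (algebraMap R S))
    (hϖ : Irreducible ϖ) (hϖS : Irreducible (algebraMap R S ϖ)) {n : ℕ} (hn : 1 ≤ n) :
    ((unitsMap (R := R) (S := S)).range ⊔ higherUnits (algebraMap R S ϖ) n).index *
        (Nat.card (IsLocalRing.ResidueField R)ˣ *
          Nat.card (IsLocalRing.ResidueField R) ^ (n - 1)) =
      Nat.card (IsLocalRing.ResidueField S)ˣ * Nat.card (IsLocalRing.ResidueField S) ^ (n - 1) := by
  rw [← index_higherUnits hϖ hn, ← index_higherUnits hϖS hn]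
  exact index_sup_mul_index hinj hϖ hϖS n

/-- Lemma N5.L4(iii), COUNTS at an inert place: with `|k_F| = q`, `|k_F^×| = q − 1`,
`|k_E| = q²`, `|k_E^×| = q² − 1` and `q ≥ 2`, `[U_E : U_F U_E^n] = (q + 1) q^{n−1}` for
`n ≥ 1` (for `n = 2` this is the order `(q_w + 1) q_w` of `G` in Theorem N5.T3). -/
theorem index_sup_eq_of_card (hinj : Function.Injective (algebraMap R S))
    (hϖ : Irreducible ϖ) (hϖS : Irreducible (algebraMap R S ϖ)) {n : ℕ} (hn : 1 ≤ n) {q : ℕ}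
    (hq : 2 ≤ q) (hR : Nat.card (IsLocalRing.ResidueField R) = q)
    (hRu : Nat.card (IsLocalRing.ResidueField R)ˣ = q - 1)
    (hS : Nat.card (IsLocalRing.ResidueField S) = q ^ 2)
    (hSu : Nat.card (IsLocalRing.ResidueField S)ˣ = q ^ 2 - 1) :
    ((unitsMap (R := R) (S := S)).range ⊔ higherUnits (algebraMap R S ϖ) n).index =
      (q + 1) * q ^ (n - 1) := by
  have h := index_sup_mul_eq hinj hϖ hϖS hn
  rw [hR, hRu, hS, hSu] at h
  have hpos : 0 < (q - 1) * q ^ (n - 1) := by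
    apply Nat.mul_pos (by omega) (pow_pos (by omega) _)
  apply Nat.eq_of_mul_eq_mul_right hpos
  rw [h]
  have e : q ^ 2 - 1 = (q + 1) * (q - 1) := by
    have : q ^ 2 = q * q := by ring
    rw [this, Nat.mul_sub_one, Nat.add_mul, Nat.one_mul]
    have hq1 : q ≤ q * q := Nat.le_mul_self q
    omega
  rw [e, ← pow_mul, show 2 * (n - 1) = (n - 1) + (n - 1) by ring, pow_add]
  ring

end Inert

end Summit.Ventures.HodgeRepro2.T5HigherUnitsIndex
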